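import Summits.HubbardSuperconductivity.HubbardSuperconductivity.Theorems.BalabanIRBirComplexStableXYRThinFormExact
import Summits.HubbardSuperconductivity.HubbardSuperconductivity.Theorems.BalabanIRBirComplexStableXYRCovarianceFRD
import Literature.MathematicalPhysics.QuantumFieldTheory.TorusChartHodgeDecomposition
import Literature.Analysis.Fourier.ConvolutionOperatorMultiplier
import HarnessLib

/-!
# Crux `BirComplexStableXYR` (stmt-HubbardSuperconductivity-14845), chapter-2 input (lead c7, item G2c): the lattice Laplacian
# of the space–time torus as a convolution operator, and its Green's operator as a pseudo-inverse

Support file (prover seat 1, route BalabanIR).  For the Biot–Savart law of the Coulomb representative `coexact (d₁ a)`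
(`Literature/…/TorusChartHodgeDecomposition.lean`) on `Λ L M = (ℤ/L)² × ℤ/M` one needs the Green's operator `TorusChart.green` of
the chart `piProdZMod 2 L M` in the vocabulary of the volume-uniform decay theorems (`Literature/Analysis/Matrix/TorusGreen*`):
a translation-invariant matrix with its pseudo-inverse `pinv`.  This file supplies that dictionary for the inline Laplacian
matrix `NL(x,y) = Σ_i ([y = x] − [y = x + e_i] + [y = x] − [y = x − e_i])`:

* `cfl_gen_eq` (the chart's unit translations are the three unit steps), `cfl_mulVec` (`NL·f = negLap f`),
  `cfl_translationInvariant`, `cfl_isHermitian`, `cfl_posSemidef`, `cfl_le_twelve` (`12·1 − NL ⪰ 0`),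
  `cfl_symbol_re` (`Re σ_NL(ψ) = Σ_i (2 − 2Re ψ(e_i))`, EXACT), `cfl_symbol_one` (`σ_NL(1) = 0`), `cfl_hasFiniteRange`
  (range `1` in the torus `ℓ¹` metric), `cfl_reflect` (time-reflection symmetry), `cfl_scaled_facts` (`A = NL/3`: `0 ≤ A ≤ 4`,
  coercive with `c₀ = 1/3`);
* **`cfl_green_eq_pinv_mulVec`** — `TorusChart.green (piProdZMod 2 L M) f = pinv NL ·ᵥ f`: the Green's operator of the Hodge
  layer IS the pseudo-inverse of the convolution operator (uniqueness `TorusChart.eq_green`: `pinv NL · f` is mean-zero because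
  `σ_{pinv}(1) = σ_NL(1)⁻¹ = 0`, and `NL · pinv NL = 1 − |Λ|⁻¹𝟙`).

No definitions; sorry-free. [folklore]
-/

noncomputable section

namespace Summit.HubbardSuperconductivity.HubbardSuperconductivity.Theorems

set_option linter.dupNamespace false -- summit = problem name (single-conjunct summit), D-0017

open scoped BigOperators Matrix ComplexConjugate
open Complex Summit.HubbardSuperconductivity.BirComplexStableXYNegative
open Literature.Probability.LatticeModels Literature.Analysis.Matrix Literature.Analysis.Fourier
open Literature.MathematicalPhysics.QuantumFieldTheory

section CoulombFieldLaplacian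

variable {L M : ℕ} [NeZero L] [NeZero M]

-- the three unit steps of the space-time torus (local abbreviation; inline in statements)
set_option quotPrecheck false in
local notation "Evec[" L' "," M' "]" =>
  (![((![1, 0] : Literature.Probability.LatticeModels.TorusSite 2 L'), (0 : ZMod M')), (![0, 1], 0), (0, 1)]
    : Fin 3 → Λ L' M')

-- the inline lattice Laplacian matrix (local abbreviation; inline in statements)
set_option quotPrecheck false in
local notation "NL[" L' "," M' "]" => (Matrix.of fun x y : Λ L' M' =>
  ∑ i : Fin 3, (((if y = x then (1 : ℝ) else 0) - (if y = x + Evec[L',M'] i then (1 : ℝ) else 0))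
    + ((if y = x then (1 : ℝ) else 0) - (if y = x - Evec[L',M'] i then (1 : ℝ) else 0))))

-- the torus `ℓ¹` distance (local abbreviation; inline in statements)
set_option quotPrecheck false in
local notation "tdist[" L' "," M' "]" => (fun i j : Λ L' M' =>
  ((j.1 0 - i.1 0).valMinAbs.natAbs + (j.1 1 - i.1 1).valMinAbs.natAbs + (j.2 - i.2).valMinAbs.natAbs))

/-! ## The chart's unit translations -/

/-- The unit translations of the chart `piProdZMod 2 L M` are the three unit steps. [folklore] -/
theorem cfl_gen_eq (i : Fin 3) : (TorusChart.piProdZMod 2 L M).gen i = Evec[L,M] i := by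
  fin_cases i
  · show (TorusChart.piProdZMod 2 L M).gen 0 = (![1, 0], 0)
    rw [tfe_gen_zero]
    refine Prod.ext ?_ rfl
    funext k; fin_cases k <;> simp
  · show (TorusChart.piProdZMod 2 L M).gen 1 = (![0, 1], 0)
    rw [tfe_gen_one]
    refine Prod.ext ?_ rfl
    funext k; fin_cases k <;> simp
  · show (TorusChart.piProdZMod 2 L M).gen 2 = (0, 1)
    rw [tfe_gen_two]

/-! ## The Laplacian matrix acts as `negLap` -/

/-- **`NL · f = negLap f`.** [folklore] -/
theorem cfl_mulVec (f : Λ L M → ℝ) : NL[L,M] *ᵥ f = (TorusChart.piProdZMod 2 L M).negLap f := by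
  funext x
  rw [TorusChart.negLap_apply]
  simp only [Matrix.mulVec, dotProduct, Matrix.of_apply, Finset.sum_mul]
  rw [Finset.sum_comm]
  refine Finset.sum_congr rfl fun i _ => ?_
  simp only [add_mul, sub_mul, ite_mul, one_mul, zero_mul, Finset.sum_add_distrib, Finset.sum_sub_distrib,
    Finset.sum_ite_eq', Finset.mem_univ, if_true, cfl_gen_eq]

omit [NeZero L] [NeZero M] in
/-- `NL` is translation invariant. [folklore] -/
theorem cfl_translationInvariant : IsTranslationInvariant (NL[L,M]) := by
  intro g x y
  simp only [Matrix.of_apply]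
  refine Finset.sum_congr rfl fun i _ => ?_
  have h1 : (y + g = x + g) ↔ (y = x) := add_left_inj g
  have h2 : (y + g = x + g + Evec[L,M] i) ↔ (y = x + Evec[L,M] i) := by rw [add_right_comm, add_left_inj]
  have h3 : (y + g = x + g - Evec[L,M] i) ↔ (y = x - Evec[L,M] i) := by rw [sub_eq_add_neg, add_right_comm, ← sub_eq_add_neg, add_left_inj]
  simp only [h1, h2, h3]

omit [NeZero L] [NeZero M] in
/-- `NL` is symmetric. [folklore] -/
theorem cfl_isHermitian : (NL[L,M]).IsHermitian := by
  refine Matrix.IsHermitian.ext fun x y => ?_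
  simp only [star_trivial, Matrix.of_apply]
  refine Finset.sum_congr rfl fun i _ => ?_
  have h1 : (x = y) ↔ (y = x) := eq_comm
  have h2 : (x = y + Evec[L,M] i) ↔ (y = x - Evec[L,M] i) := by constructor <;> intro h <;> rw [h] <;> abel
  have h3 : (x = y - Evec[L,M] i) ↔ (y = x + Evec[L,M] i) := by constructor <;> intro h <;> rw [h] <;> abel
  simp only [h1, h2, h3]
  ring

/-- The quadratic form of `NL` is the Dirichlet energy. [folklore] -/
theorem cfl_form_eq (u : Λ L M → ℝ) :
    u ⬝ᵥ (NL[L,M] *ᵥ u) = ∑ x, ∑ i, ((TorusChart.piProdZMod 2 L M).d₀ u x i) ^ 2 := by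
  rw [cfl_mulVec, dotProduct, (TorusChart.piProdZMod 2 L M).sum_mul_negLap u u]
  exact Finset.sum_congr rfl fun x _ => Finset.sum_congr rfl fun i _ => (sq _).symm

/-- `NL ⪰ 0`. [folklore] -/
theorem cfl_posSemidef : (NL[L,M]).PosSemidef := by
  refine Matrix.PosSemidef.of_dotProduct_mulVec_nonneg cfl_isHermitian fun u => ?_
  rw [star_trivial, cfl_form_eq]
  exact Finset.sum_nonneg fun x _ => Finset.sum_nonneg fun i _ => sq_nonneg _

/-- **`NL ⪯ 12`**: `‖d₀u‖² ≤ 12‖u‖²` (each difference `(a − b)² ≤ 2a² + 2b²`, three directions). [folklore] -/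
theorem cfl_le_twelve : ((12 : ℝ) • (1 : Matrix (Λ L M) (Λ L M) ℝ) - NL[L,M]).PosSemidef := by
  refine Matrix.PosSemidef.of_dotProduct_mulVec_nonneg
    ((Matrix.isHermitian_one.smul (IsSelfAdjoint.all _)).sub cfl_isHermitian) fun u => ?_
  rw [star_trivial, Matrix.sub_mulVec, dotProduct_sub, Matrix.smul_mulVec, Matrix.one_mulVec, dotProduct_smul,
    smul_eq_mul, cfl_form_eq, sub_nonneg]
  have hbound : ∀ i : Fin 3, ∑ x, ((TorusChart.piProdZMod 2 L M).d₀ u x i) ^ 2 ≤ 4 * (u ⬝ᵥ u) := by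
    intro i
    calc ∑ x, ((TorusChart.piProdZMod 2 L M).d₀ u x i) ^ 2
        ≤ ∑ x, (2 * u (x + (TorusChart.piProdZMod 2 L M).gen i) ^ 2 + 2 * u x ^ 2) :=
          Finset.sum_le_sum fun x _ => by
            rw [TorusChart.d₀_apply]
            nlinarith [sq_nonneg (u (x + (TorusChart.piProdZMod 2 L M).gen i) + u x)]
      _ = 4 * (u ⬝ᵥ u) := by
          rw [Finset.sum_add_distrib, ← Finset.mul_sum, ← Finset.mul_sum,
            TorusChart.sum_comp_add_eq (fun x => u x ^ 2) ((TorusChart.piProdZMod 2 L M).gen i), dotProduct]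
          simp only [sq]; ring
  rw [Finset.sum_comm]
  calc ∑ i : Fin 3, ∑ x, ((TorusChart.piProdZMod 2 L M).d₀ u x i) ^ 2 ≤ ∑ _i : Fin 3, 4 * (u ⬝ᵥ u) :=
        Finset.sum_le_sum fun i _ => hbound i
    _ = 12 * (u ⬝ᵥ u) := by rw [Finset.sum_const, Finset.card_univ, Fintype.card_fin]; ring

/-! ## The symbol -/

/-- **The symbol of `NL` is the dispersion**: `σ_NL(ψ) = Σ_i (2 − ψ(e_i) − ψ(−e_i))`. [folklore] -/
theorem cfl_symbol (ψ : AddChar (Λ L M) ℂ) :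
    symbol (NL[L,M]) ψ = ∑ i : Fin 3, (2 - ψ (Evec[L,M] i) - ψ (-(Evec[L,M] i))) := by
  unfold symbol
  simp only [Matrix.of_apply, zero_add, zero_sub, Complex.ofReal_sum, Complex.ofReal_add, Complex.ofReal_sub,
    Finset.sum_mul, add_mul, sub_mul]
  rw [Finset.sum_comm]
  refine Finset.sum_congr rfl fun i _ => ?_
  simp only [apply_ite Complex.ofReal, Complex.ofReal_one, Complex.ofReal_zero, ite_mul, one_mul, zero_mul,
    Finset.sum_add_distrib, Finset.sum_sub_distrib, Finset.sum_ite_eq', Finset.mem_univ, if_true,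
    AddChar.map_zero_eq_one]
  ring

/-- The real part of the symbol: `Re σ_NL(ψ) = Σ_i (2 − 2Re ψ(e_i))`. [folklore] -/
theorem cfl_symbol_re (ψ : AddChar (Λ L M) ℂ) :
    (symbol (NL[L,M]) ψ).re = ∑ i : Fin 3, (2 - 2 * (ψ (Evec[L,M] i)).re) := by
  rw [cfl_symbol, Complex.re_sum]
  refine Finset.sum_congr rfl fun i _ => ?_
  rw [AddChar.map_neg_eq_conj, Complex.sub_re, Complex.sub_re, Complex.conj_re]
  norm_num
  ring

/-- The symbol vanishes at the trivial character (zero row sums). [folklore] -/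
theorem cfl_symbol_one : symbol (NL[L,M]) 1 = 0 := by
  rw [cfl_symbol]; norm_num

/-! ## Finite range and time reflection -/

/-- Unit steps have torus length `≤ 1`. [folklore] -/
theorem cfl_step_le_one (i : Fin 3) (x : Λ L M) :
    tdist[L,M] x (x + Evec[L,M] i) ≤ 1 ∧ tdist[L,M] x (x - Evec[L,M] i) ≤ 1 := by
  have hL1 := cfrd_valMinAbs_natCast_sub_le (n := L) (r := 2) 1 0 (by norm_num) (by norm_num)
  have hM1 := cfrd_valMinAbs_natCast_sub_le (n := M) (r := 2) 1 0 (by norm_num) (by norm_num)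
  simp only [Nat.cast_one, Nat.cast_zero, sub_zero] at hL1 hM1
  fin_cases i <;> constructor <;>
    simp [ZMod.valMinAbs_zero, Matrix.cons_val_zero, Matrix.cons_val_one, sub_eq_add_neg, hL1, hM1]

/-- `NL` has range `1` in the torus `ℓ¹` metric. [folklore] -/
theorem cfl_hasFiniteRange : HasFiniteRange (tdist[L,M]) 1 (NL[L,M]) := by
  intro x y hxy
  simp only [Matrix.of_apply]
  refine Finset.sum_eq_zero fun i _ => ?_
  have hself : ¬ (y = x) := by
    intro h; subst h
    have := cfrd_tdist_self (L := L) (M := M) y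
    simp only at this hxy
    omega
  have hplus : ¬ (y = x + Evec[L,M] i) := by
    intro h; subst h
    have := (cfl_step_le_one i x).1
    simp only at this hxy
    omega
  have hminus : ¬ (y = x - Evec[L,M] i) := by
    intro h; subst h
    have := (cfl_step_le_one i x).2
    simp only at this hxy
    omega
  simp [hself, hplus, hminus]

omit [NeZero L] [NeZero M] in
/-- The time reflection `(x, t) ↦ (x, −t)` acts coordinatewise. [folklore] -/
theorem cfl_timeReflection_apply (z : Λ L M) :
    (AddEquiv.prodCongr (AddEquiv.refl (TorusSite 2 L)) (AddEquiv.neg (ZMod M))) z = (z.1, -z.2) := rfl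

omit [NeZero L] [NeZero M] in
/-- **Time-reflection symmetry of `NL`**: `NL (τ x) (τ y) = NL x y` for `τ (x, t) = (x, −t)` (the set of unit steps `{±e_i}` is
reflection invariant). [folklore] -/
theorem cfl_reflect (x y : Λ L M) :
    NL[L,M] ((AddEquiv.prodCongr (AddEquiv.refl (TorusSite 2 L)) (AddEquiv.neg (ZMod M))) x)
        ((AddEquiv.prodCongr (AddEquiv.refl (TorusSite 2 L)) (AddEquiv.neg (ZMod M))) y) = NL[L,M] x y := by
  set τ := AddEquiv.prodCongr (AddEquiv.refl (TorusSite 2 L)) (AddEquiv.neg (ZMod M)) with hτ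
  simp only [Matrix.of_apply]
  refine Finset.sum_congr rfl fun i _ => ?_
  have hinv : ∀ z : Λ L M, τ (τ z) = z := fun z => by
    rw [cfl_timeReflection_apply, cfl_timeReflection_apply]; simp
  have hiff1 : (τ y = τ x) ↔ (y = x) := τ.apply_eq_iff_eq
  have hiff2 : (τ y = τ x + Evec[L,M] i) ↔ (y = x + τ (Evec[L,M] i)) := by
    constructor
    · intro h; apply τ.injective; rw [map_add, hinv, h]
    · intro h; rw [h, map_add, hinv]
  have hiff3 : (τ y = τ x - Evec[L,M] i) ↔ (y = x - τ (Evec[L,M] i)) := by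
    constructor
    · intro h; apply τ.injective; rw [map_sub, hinv, h]
    · intro h; rw [h, map_sub, hinv]
  have hE : τ (Evec[L,M] i) = Evec[L,M] i ∨ τ (Evec[L,M] i) = -(Evec[L,M] i) := by
    fin_cases i
    · left; rw [cfl_timeReflection_apply]; simp
    · left; rw [cfl_timeReflection_apply]; simp
    · right; rw [cfl_timeReflection_apply]; simp
  rcases hE with h | h
  · simp only [hiff1, hiff2, hiff3, h]
  · simp only [hiff1, hiff2, hiff3, h, sub_neg_eq_add, ← sub_eq_add_neg]
    ring

/-! ## The rescaled Laplacian `A = NL/3` -/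

/-- **`A = NL/3`**: symmetric, translation invariant, `0 ≤ A ≤ 4`, with symbol EXACTLY `(1/3)Σ_i(2 − 2Re ψ(e_i))`
(coercivity constant `c₀ = 1/3`). [folklore] -/
theorem cfl_scaled_facts :
    (((1 / 3 : ℝ)) • NL[L,M]).IsHermitian ∧ IsTranslationInvariant (((1 / 3 : ℝ)) • NL[L,M])
      ∧ (((1 / 3 : ℝ)) • NL[L,M]).PosSemidef
      ∧ ((4 : ℝ) • (1 : Matrix (Λ L M) (Λ L M) ℝ) - ((1 / 3 : ℝ)) • NL[L,M]).PosSemidef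
      ∧ ∀ ψ : AddChar (Λ L M) ℂ, (1 / 3 : ℝ) * ∑ i : Fin 3, (2 - 2 * (ψ (Evec[L,M] i)).re)
          ≤ (symbol (((1 / 3 : ℝ)) • NL[L,M]) ψ).re := by
  refine ⟨cfl_isHermitian.smul (IsSelfAdjoint.all _), cfl_translationInvariant.smul _,
    cfl_posSemidef.smul (by norm_num), ?_, fun ψ => ?_⟩
  · have : (4 : ℝ) • (1 : Matrix (Λ L M) (Λ L M) ℝ) - (1 / 3 : ℝ) • NL[L,M]
        = (1 / 3 : ℝ) • ((12 : ℝ) • (1 : Matrix (Λ L M) (Λ L M) ℝ) - NL[L,M]) := by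
      rw [smul_sub, smul_smul]; norm_num
    rw [this]
    exact cfl_le_twelve.smul (by norm_num)
  · rw [symbol_smul, Complex.mul_re, Complex.ofReal_re, Complex.ofReal_im, zero_mul, sub_zero, cfl_symbol_re]

/-! ## The Green's operator of the chart is the pseudo-inverse of `NL` -/

/-- Row sums of `pinv NL` vanish: the pseudo-inverse has zero symbol at the trivial character. [folklore] -/
theorem cfl_sum_pinv_apply (x : Λ L M) : ∑ y, pinv (NL[L,M]) x y = 0 := by
  have h := symbol_pinv (NL[L,M]) 1
  rw [cfl_symbol_one, inv_zero] at h
  unfold symbol at h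
  simp only [AddChar.one_apply, mul_one] at h
  have h0 : ∑ y, pinv (NL[L,M]) 0 y = 0 := by exact_mod_cast h
  have htr := isTranslationInvariant_pinv (NL[L,M])
  calc ∑ y, pinv (NL[L,M]) x y = ∑ y, pinv (NL[L,M]) (0 + x) (y - x + x) := by simp
    _ = ∑ y, pinv (NL[L,M]) 0 (y - x) := Finset.sum_congr rfl fun y _ => htr x 0 (y - x)
    _ = ∑ y, pinv (NL[L,M]) 0 y := (TorusChart.sum_comp_sub_eq (fun y => pinv (NL[L,M]) 0 y) x)
    _ = 0 := h0

/-- `pinv NL · f` has zero total. [folklore] -/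
theorem cfl_sum_pinv_mulVec (f : Λ L M → ℝ) : ∑ x, (pinv (NL[L,M]) *ᵥ f) x = 0 := by
  simp only [Matrix.mulVec, dotProduct]
  rw [Finset.sum_comm]
  refine Finset.sum_eq_zero fun y _ => ?_
  rw [← Finset.sum_mul]
  -- column sums = row sums by symmetry of the pseudo-inverse of a symmetric matrix
  have hsreal : ∀ ψ : AddChar (Λ L M) ℂ, conj ((symbol (NL[L,M]) ψ)⁻¹) = (symbol (NL[L,M]) ψ)⁻¹ := fun ψ => by
    rw [map_inv₀, conj_symbol ψ cfl_translationInvariant cfl_isHermitian]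
  have hc : ((Fintype.card (Λ L M) : ℂ))⁻¹ = (((Fintype.card (Λ L M) : ℝ))⁻¹ : ℝ) := by push_cast; rfl
  have heven : ∀ z : Λ L M, pinv (NL[L,M]) 0 (-z) = pinv (NL[L,M]) 0 z := by
    intro z
    simp only [pinv, mulKernel_apply, mulKernelC_apply, zero_sub, neg_neg]
    have hsum : (∑ ψ : AddChar (Λ L M) ℂ, (symbol (NL[L,M]) ψ)⁻¹ * ψ (-z))
        = conj (∑ ψ : AddChar (Λ L M) ℂ, (symbol (NL[L,M]) ψ)⁻¹ * ψ z) := by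
      rw [map_sum]
      refine Finset.sum_congr rfl fun ψ _ => ?_
      rw [map_mul, hsreal, AddChar.map_neg_eq_conj]
    rw [hsum, hc, Complex.re_ofReal_mul, Complex.re_ofReal_mul, Complex.conj_re]
  have hsym : ∀ x, pinv (NL[L,M]) x y = pinv (NL[L,M]) y x := by
    intro x
    have htr := isTranslationInvariant_pinv (NL[L,M])
    rw [htr.apply_eq x y, htr.apply_eq y x, show x - y = -(y - x) by abel, heven]
  rw [Finset.sum_congr rfl fun x _ => hsym x, cfl_sum_pinv_apply y, zero_mul]

/-- **The Green's operator of the space–time chart is the pseudo-inverse of the Laplacian matrix**: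
`green (piProdZMod 2 L M) f = pinv NL · f`. [folklore] -/
theorem cfl_green_eq_pinv_mulVec (f : Λ L M → ℝ) :
    (TorusChart.piProdZMod 2 L M).green f = pinv (NL[L,M]) *ᵥ f := by
  symm
  refine (TorusChart.piProdZMod 2 L M).eq_green (cfl_sum_pinv_mulVec f) ?_
  rw [← cfl_mulVec, Matrix.mulVec_mulVec]
  have h0 : ∀ ψ : AddChar (Λ L M) ℂ, symbol (NL[L,M]) ψ = 0 ↔ ψ = 1 := by
    intro ψ
    constructor
    · intro h
      -- a vanishing dispersion forces `ψ(e_i) = 1` for all `i`, hence `ψ = 1`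
      have hre := congrArg Complex.re h
      rw [cfl_symbol_re, Complex.zero_re] at hre
      have hnn : ∀ i, 0 ≤ 2 - 2 * (ψ (Evec[L,M] i)).re := fun i =>
        two_sub_two_re_nonneg (L := (![L, L, M] : Fin 3 → ℕ) i)
          (by fin_cases i <;> simp [NeZero.ne L, NeZero.ne M]) (cfrd_order i) ψ
      have hz := (Finset.sum_eq_zero_iff_of_nonneg fun i _ => hnn i).1 hre
      refine cfrd_addChar_ext ψ 1 fun i => ?_
      have hi := hz i (Finset.mem_univ i)
      -- `Re ψ(e) = 1` with `‖ψ(e)‖ = 1` forces `ψ(e) = 1`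
      have hn := AddChar.norm_apply ψ (Evec[L,M] i)
      have hre1 : (ψ (Evec[L,M] i)).re = 1 := by linarith
      have him : (ψ (Evec[L,M] i)).im = 0 := by
        have h2 : ‖ψ (Evec[L,M] i)‖ ^ 2 = 1 := by rw [hn]; norm_num
        rw [Complex.sq_norm, Complex.normSq_apply, hre1] at h2
        nlinarith
      rw [AddChar.one_apply]
      exact Complex.ext (by simp [hre1]) (by simp [him])
    · rintro rfl; exact cfl_symbol_one
  rw [mul_pinv_eq_one_sub_avg cfl_translationInvariant h0, Matrix.sub_mulVec, Matrix.one_mulVec]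
  funext x
  simp only [Pi.sub_apply, Matrix.mulVec, dotProduct, Matrix.of_apply, ← Finset.mul_sum, TorusChart.mean_def]
  ring

/-- **Registered stub `birGreen_eq_pinv` (prover seat 1, stmt-HubbardSuperconductivity-14845): the Green's operator of the space–time
chart is the pseudo-inverse of the inline Laplacian matrix** (closed form of `cfl_green_eq_pinv_mulVec`). [folklore] -/
theorem birGreen_eq_pinv : ∀ (L M : ℕ) [NeZero L] [NeZero M] (f : Λ L M → ℝ), (Literature.MathematicalPhysics.QuantumFieldTheory.TorusChart.piProdZMod 2 L M).green f = Literature.Analysis.Fourier.pinv (Matrix.of fun x y : Λ L M => ∑ i : Fin 3, (((if y = x then (1 : ℝ) else 0) - (if y = x + (![((![1, 0] : Literature.Probability.LatticeModels.TorusSite 2 L), (0 : ZMod M)), (![0, 1], 0), (0, 1)] : Fin 3 → Λ L M) i then (1 : ℝ) else 0)) + ((if y = x then (1 : ℝ) else 0) - (if y = x - (![((![1, 0] : Literature.Probability.LatticeModels.TorusSite 2 L), (0 : ZMod M)), (![0, 1], 0), (0, 1)] : Fin 3 → Λ L M) i then (1 : ℝ) else 0)))) *ᵥ f :=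
  fun _ _ _ _ f => cfl_green_eq_pinv_mulVec f

end CoulombFieldLaplacian

end Summit.HubbardSuperconductivity.HubbardSuperconductivity.Theorems

end
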